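import Mathlib

/-!
# QRFM restored count — DEQ-A166, Lemma A166-3 and the arithmetic of Proposition A166-2 (receipt; fully proved)

HONEST FRAMING: instance-level adjudication of specific advantage claims; no claim about
BQP vs BPP or the summit.

Source: Hu–Jin–Liu–Zhang, *Quantum random feature method for solving partial differential
equations*, arXiv:2510.07945v1 = Discrete Contin. Dyn. Syst. 55 (2026) 497–519, §3.3 step 5
(PDF p. 10): the solution state is produced by `U_u = (I ⊗ H^{⊗m}) U_{σ(wx+b)} (H^{⊗n} ⊗ I) U_v`,
where `U_{σ(wx+b)}` block-encodes the `MN × MN` diagonal `diag(φ_j(x_i))` with normalisation `1`.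
DEQ-A166 (pub-qadeq-deq-1/DEQ-A166.md) Lemma A166-3: the amplitude of this circuit on
`|i⟩|0^m⟩` is `(Φ v)_i / (√(MN) ‖v‖)`, because the column of `H^{⊗n}` at `|0^n⟩` and the row of
`H^{⊗m}` at `⟨0^m|` are the uniform vectors `1/√N`, `1/√M`; hence the step post-selects with
probability `‖Φv‖² / (MN‖v‖²)`, a factor absent from the paper's Theorem 5.  Proposition A166-2
multiplies the three factors of the pipeline (QSVT degree `α/σ`, linear-solver amplitude
`σ‖v‖/(2‖f‖)` — Gilyén–Su–Low–Wiebe arXiv:1806.01838 Thm. 40 — and the step-5 amplitude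
`‖u‖/(β‖v‖)`) into `2αβ‖f‖/(σ²‖u‖)`; `‖v‖` cancels.  Finally, for a matrix with entries of
absolute value `≤ 1` any lower singular bound `σ` satisfies `σ² ≤ card(rows)`, so with the paper's
normalisations `α = β = √(MN)` the restored count is at least `2M‖f‖/‖u‖`.

This file proves exactly these finite-sum / field identities and the entry bound, for real
matrices indexed by `Fintype`s.  Nothing here refers to quantum states: the statements are the
linear-algebra content only.

Intended tree location (to be filed by a permitted role, not by a planner seat):
`lean/Summits/QuantumAdvantage/Dequantization/QRFMRestoredCount.lean`.
-/

namespace Summit.QuantumAdvantage.Dequantization.QRFMRestoredCount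

open Matrix Finset

variable {ι κ : Type*} [Fintype κ]

/-- Lemma A166-3 (step-5 amplitude).  With `hN = 1/√N` the entries of `H^{⊗n}|0^n⟩`, `hM = 1/√M`
the entries of `⟨0^m|H^{⊗m}`, `c = 1/‖v‖` the normalisation of `|v⟩` and `d i j = φ_j(x_i)` the
diagonal, the amplitude on `|i⟩|0^m⟩` of `(I ⊗ H^{⊗m}) · diag(d) · (H^{⊗n} ⊗ I) (|0^n⟩ ⊗ c•v)` is
`∑_j hM · d_{ij} · hN · c · v_j = (hM·hN·c) · (Φ v)_i`. -/
theorem stepFive_amplitude (d : ι → κ → ℝ) (v : κ → ℝ) (hN hM c : ℝ) (i : ι) :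
    ∑ j, hM * (d i j * (hN * (c * v j))) = (hM * hN * c) * ∑ j, d i j * v j := by
  rw [Finset.mul_sum]
  refine Finset.sum_congr rfl fun j _ => ?_
  ring

/-- The two Hadamard normalisations combine to `1/√(MN)`. -/
theorem inv_sqrt_mul_inv_sqrt {M N : ℝ} (hM : 0 ≤ M) :
    (1 / Real.sqrt M) * (1 / Real.sqrt N) = 1 / Real.sqrt (M * N) := by
  rw [Real.sqrt_mul hM N]
  ring

/-- Step-5 success probability: `∑_i ((hM·hN·c)·(Φv)_i)² = (hM·hN·c)² · ∑_i (Φv)_i²`, i.e.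
`p₅ = ‖Φv‖² / (MN‖v‖²)` once `hM·hN·c = 1/(√(MN)‖v‖)`. -/
theorem stepFive_successProb [Fintype ι] (d : ι → κ → ℝ) (v : κ → ℝ) (hN hM c : ℝ) :
    ∑ i, (∑ j, hM * (d i j * (hN * (c * v j)))) ^ 2
      = (hM * hN * c) ^ 2 * ∑ i, (∑ j, d i j * v j) ^ 2 := by
  simp_rw [stepFive_amplitude, mul_pow]
  rw [Finset.mul_sum]

/-- Proposition A166-2 (arithmetic of the restored count).  QSVT degree scale `α/σ`, inverse
linear-solver amplitude `2‖f‖/(σ‖v‖)` (the solver block-encodes `(σ/(2α))·Ã⁺`, GSLW Thm. 40),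
inverse step-5 amplitude `β‖v‖/‖u‖`: the product is `2αβ‖f‖/(σ²‖u‖)` — the coefficient norm
`‖v‖` cancels. -/
theorem restoredCount_eq {α β σ f v u : ℝ} (hσ : σ ≠ 0) (hv : v ≠ 0) (hu : u ≠ 0) :
    (α / σ) * (2 * f / (σ * v)) * (β * v / u) = 2 * α * β * f / (σ ^ 2 * u) := by
  field_simp

section entries

variable {n m : Type*} [Fintype n]

/-- If `σ` is a lower singular bound of `A` (`σ²‖x‖² ≤ ‖Ax‖²` for all `x`), then `σ²` is at most
the squared norm of every column (test vector `x = e_j`). -/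
theorem lowerSingular_sq_le_colNormSq [Fintype m] [DecidableEq m] (A : Matrix n m ℝ) (σ : ℝ)
    (hσ : ∀ x : m → ℝ, σ ^ 2 * (x ⬝ᵥ x) ≤ (A *ᵥ x) ⬝ᵥ (A *ᵥ x)) (j : m) :
    σ ^ 2 ≤ ∑ i, (A i j) ^ 2 := by
  have h := hσ (Pi.single j 1)
  rw [Matrix.mulVec_single_one, single_dotProduct] at h
  simpa [dotProduct, Matrix.col_apply, sq] using h

/-- Entries of absolute value `≤ 1` give column norms `≤ card n`. -/
theorem colNormSq_le_card (A : Matrix n m ℝ) (hA : ∀ i j, |A i j| ≤ 1) (j : m) :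
    ∑ i, (A i j) ^ 2 ≤ (Fintype.card n : ℝ) := by
  calc ∑ i, (A i j) ^ 2 ≤ ∑ _i : n, (1 : ℝ) :=
        Finset.sum_le_sum fun i _ => (sq_le_one_iff_abs_le_one _).mpr (hA i j)
    _ = (Fintype.card n : ℝ) := by simp

/-- Hence a lower singular bound of an entry-normalised matrix satisfies `σ² ≤ card n`
(the number of rows); used in DEQ-A166 §5 as `MN/σ_min(A_q)² ≥ M`. -/
theorem lowerSingular_sq_le_card [Fintype m] [DecidableEq m] [Nonempty m] (A : Matrix n m ℝ) (hA : ∀ i j, |A i j| ≤ 1)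
    (σ : ℝ) (hσ : ∀ x : m → ℝ, σ ^ 2 * (x ⬝ᵥ x) ≤ (A *ᵥ x) ⬝ᵥ (A *ᵥ x)) :
    σ ^ 2 ≤ (Fintype.card n : ℝ) := by
  obtain ⟨j⟩ := ‹Nonempty m›
  exact (lowerSingular_sq_le_colNormSq A σ hσ j).trans (colNormSq_le_card A hA j)

/-- The restored count with the paper's normalisations `α = β = √(MN)`:
`2·(√(MN))²·f/(σ²u) ≥ 2·M·f/u` whenever `σ² ≤ N`, `σ ≠ 0` and `f/u ≥ 0`. -/
theorem restoredCount_ge {M N σ f u : ℝ} (hM : 0 ≤ M) (hN : 0 ≤ N) (hσ : σ ≠ 0)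
    (hσN : σ ^ 2 ≤ N) (hfu : 0 ≤ f / u) :
    2 * M * (f / u) ≤ 2 * (Real.sqrt (M * N)) ^ 2 * f / (σ ^ 2 * u) := by
  have hsq : (Real.sqrt (M * N)) ^ 2 = M * N := Real.sq_sqrt (mul_nonneg hM hN)
  rw [hsq]
  have hσpos : 0 < σ ^ 2 := by positivity
  have key : M ≤ M * N / σ ^ 2 := by
    rw [le_div_iff₀ hσpos]
    exact mul_le_mul_of_nonneg_left hσN hM
  calc 2 * M * (f / u) ≤ 2 * (M * N / σ ^ 2) * (f / u) := by
        have := mul_le_mul_of_nonneg_right key hfu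
        nlinarith [this]
    _ = 2 * (M * N) * f / (σ ^ 2 * u) := by ring

end entries

end Summit.QuantumAdvantage.Dequantization.QRFMRestoredCount
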